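import Mathlib
import Summits.PneNP.PneNP.Theorems.PstarGapNeedsExpansion
import Summits.PneNP.PneNP.Theorems.PstarGapOne

/-!
# `¬ GapLemmaSOWithoutExpansion` by name (ROUND-24 item T24.8f, closer)

FRONTIER range-avoidance ladder (cell `pnp-ideate`, ROUND-24 gap-lemma programme; restricted-model combinatorics — nothing here bears
on `P` versus `NP`).

The planner's conjecture def `PstarGapOne.GapLemmaSOWithoutExpansion` (the simple-overlap gap lemma with the boundary-expansion
hypothesis removed) is refuted by name: it is verbatim the statement refuted by
`PstarGapNeedsExpansion.gapLemmaSO_false_without_expanding` (the `N`-fold `K_{3,3}` / nine-cycle gadget).  Harmless to the crux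
`PstarGapLemmaSO` (`PstarGapOne.gapLemmaSO_of_without` goes the other way); it records that expansion on the cyclic part of the XOR
graph is where any proof of the crux must work.
-/

set_option linter.dupNamespace false -- `Summit.PneNP.PneNP.…`: summit = sub-problem name (D-0017 single-conjunct layout)

namespace Summit.PneNP.PneNP.Theorems.PstarGapNeedsExpansion

/-- **T24.8f by name: the expansion-free simple-overlap gap lemma is false.**  Restricted-model negative result; nothing about
`P` versus `NP`. -/
theorem not_gapLemmaSOWithoutExpansion : ¬ PstarGapOne.GapLemmaSOWithoutExpansion := by
  unfold PstarGapOne.GapLemmaSOWithoutExpansion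
  exact gapLemmaSO_false_without_expanding

end Summit.PneNP.PneNP.Theorems.PstarGapNeedsExpansion
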